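import Summits.AnomalousDissipation.AnomalousDissipation.Theorems.SolenoidalFractalHomogenisationLagrangianStepD1ResidueCertDefs
import HarnessLib

/-!
# D1 residue certificate (CERT-(i) v0) — part 2/3: the NUMERATOR `bsymb (pairQS S)(k;p,q)² ≤ N̄(k,p)·N̄(k,q)` on `NearIso S (10/11) (11/10)`

The chain: `bsymb_pairQS` (pair by pair), `form_PRP`/`form_pairResp` (`pᵀ P R P q` = the double-integral form of `abs_pairForm_le`),
`abs_pairForm_le'` with floor `10/11` on all of `ℝ³` (`window_regBlock`, no odd/τ charge), the exponential-free class enclosures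
`4(11/10)⁴/T_c³ ≤ 2·nC_c` (`crude_le_nC`, `pi_sq_bounds`), AM-GM pair → slots (`pair_term_le`, `Nbar_eq_pairs`), Cauchy–Schwarz over pairs.
Port note (prover ad-k1loc-p3 g8, CERT-(i)-LAND, ruling D26-9): texts verbatim from planner ad-ideate-p5's crux spine v3
`Cruxes/LagrangianRenormalisationStep/Lines/onelevel_D1_residue_cert.lean` (sha12 7c5da58463df, sorry-free) / pre-cut port; `pairW` lives in part 1/3.
-/

set_option linter.dupNamespace false

namespace Summit.AnomalousDissipation.AnomalousDissipation.Theorems.SolenoidalFractalHomogenisation.LagrangianStep.D1ResidueCert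

open Summit.AnomalousDissipation.AnomalousDissipation.Theorems
open Summit.AnomalousDissipation.AnomalousDissipation.Theorems.SolenoidalFractalHomogenisation.LagrangianStep
open Summit.AnomalousDissipation.AnomalousDissipation.Theorems.SolenoidalFractalHomogenisation.LagrangianStep.WCrossing
open Summit.AnomalousDissipation.AnomalousDissipation.Theorems.SolenoidalFractalHomogenisation.LagrangianStep.WEvenCert
open Literature.Analysis Literature.Analysis.FluidPDE Literature.Analysis.FunctionSpaces
open Set Real

noncomputable section


/-- `slotT = Tj` (the `WEvenCert` slot time). -/
theorem slotT_eq (j : Fin 26) : slotT j = Tj j := by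
  show 4 * Real.pi ^ 2 * ‖Torus.latticeVec (slots j).m‖ ^ 2 * MB * ((slots j).τ : ℝ) = _
  rw [norm_sq_m]; rfl

/-- `slotT > 0`. -/
theorem slotT_pos (j : Fin 26) : 0 < slotT j := by rw [slotT_eq]; exact Tj_pos j

/-- Integer pair data: the slots `2l`, `2l+1` share `m` and `τ` (by `decide` on the table). -/
private theorem pair_data (l : Fin 13) :
    (slots (sndSlot l)).m = (slots (fstSlot l)).m ∧ (slots (sndSlot l)).τ = (slots (fstSlot l)).τ := by
  revert l; unfold fstSlot sndSlot; decide

/-- The slots of a pair share `m̂`. -/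
private theorem nj_snd (l : Fin 13) : nj (sndSlot l) = nj (fstSlot l) := by
  funext a
  show Torus.latticeVec (slots (sndSlot l)).m a / ‖Torus.latticeVec (slots (sndSlot l)).m‖
    = Torus.latticeVec (slots (fstSlot l)).m a / ‖Torus.latticeVec (slots (fstSlot l)).m‖
  rw [(pair_data l).1]

/-- The slots of a pair share `|m|²`. -/
private theorem Mq_snd (l : Fin 13) : Mq (slots (sndSlot l)) = Mq (slots (fstSlot l)) := by
  unfold Mq; rw [(pair_data l).1]

/-- The slots of a pair share the slot prefactor. -/
private theorem slotCoef_snd (l : Fin 13) : slotCoef cubatureWord (sndSlot l) = slotCoef cubatureWord (fstSlot l) := by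
  show ((slots (sndSlot l)).τ : ℝ) / (2 * (2 * Real.pi * ‖Torus.latticeVec (slots (sndSlot l)).m‖) ^ 4) / cubatureWord.period
    = ((slots (fstSlot l)).τ : ℝ) / (2 * (2 * Real.pi * ‖Torus.latticeVec (slots (fstSlot l)).m‖) ^ 4) / cubatureWord.period
  rw [(pair_data l).1, (pair_data l).2]

/-- The slots of a pair share the class constant `nC`. -/
private theorem nC_snd (l : Fin 13) : nC (sndSlot l) = nC (fstSlot l) := by
  unfold nC; rw [Mq_snd]

/-- The slots of a pair share `|P p|²`. -/
private theorem PpSq_snd (l : Fin 13) (p : Fin 3 → ℝ) : PpSq (sndSlot l) p = PpSq (fstSlot l) p := by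
  show ∑ i, ((projPerp (nj (sndSlot l))).mulVec p i) ^ 2 = ∑ i, ((projPerp (nj (fstSlot l))).mulVec p i) ^ 2
  rw [nj_snd]

/-- Re-indexing the 26 slots as 13 colinear adjacent pairs. -/
private theorem sum_slots_pairs (f : Fin 26 → ℝ) : ∑ j, f j = ∑ l : Fin 13, (f (fstSlot l) + f (sndSlot l)) := by
  rw [← Equiv.sum_comp (finProdFinEquiv : Fin 13 × Fin 2 ≃ Fin 26) f, Fintype.sum_prod_type]
  refine Finset.sum_congr rfl fun l _ => ?_
  have h0 : (finProdFinEquiv : Fin 13 × Fin 2 ≃ Fin 26) (l, 0) = fstSlot l := by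
    apply Fin.ext; rw [finProdFinEquiv_apply_val]; simp [fstSlot]
  have h1 : (finProdFinEquiv : Fin 13 × Fin 2 ≃ Fin 26) (l, 1) = sndSlot l := by
    apply Fin.ext; rw [finProdFinEquiv_apply_val]; simp [sndSlot]; omega
  rw [Fin.sum_univ_two, h0, h1]

/-- `N̄` summed over pairs. -/
theorem Nbar_eq_pairs (k r : Fin 3 → ℝ) : Nbar k r = ∑ l, pairW k l * PpSq (fstSlot l) r := by
  unfold Nbar
  rw [sum_slots_pairs]
  refine Finset.sum_congr rfl fun l _ => ?_
  rw [slotCoef_snd, nC_snd, PpSq_snd]; unfold pairW; ring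

/-- The bilinear symbol of ONE symmetrised pair tensor `c · sym(e ⊗ e') ⊗ Q`: `c (e·k)(e'·k) · pᵀ Q q`. -/
private theorem bsymb_pairslot (c : ℝ) (e e' : Fin 3 → ℝ) (Q : Matrix (Fin 3) (Fin 3) ℝ) (κ p q : Fin 3 → ℝ) :
    Torus.bsymb (fun i a j b => c * ((e a * e' b + e' a * e b) / 2) * Q i j) κ p q
      = c * ((∑ a, e a * κ a) * (∑ a, e' a * κ a)) * ∑ i, ∑ j, p i * Q i j * q j := by
  unfold Torus.bsymb
  simp only [Fin.sum_univ_three]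
  ring

/-- **The bilinear symbol of `pairQS`, pair by pair.** -/
theorem bsymb_pairQS (S : T4) (κ p q : Fin 3 → ℝ) :
    Torus.bsymb (pairQS S) κ p q = ∑ l : Fin 13, slotCoef cubatureWord (fstSlot l) * (ek (fstSlot l) κ * ek (sndSlot l) κ) *
      ∑ i, ∑ j, p i * pairQ S (fstSlot l) i j * q j := by
  have hfun : pairQS S = ∑ l : Fin 13, fun i a j b => slotCoef cubatureWord (fstSlot l) *
      (((cubatureWord.phase (fstSlot l)).e a * (cubatureWord.phase (sndSlot l)).e b +
        (cubatureWord.phase (sndSlot l)).e a * (cubatureWord.phase (fstSlot l)).e b) / 2) * pairQ S (fstSlot l) i j := by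
    funext i a j b; simp only [pairQS, Finset.sum_apply]
  rw [hfun, bsymb_finsetSum]
  exact Finset.sum_congr rfl fun l _ => bsymb_pairslot _ _ _ _ κ p q

/-- Joint continuity of the pair kernel entries `(s, x) ↦ (e^{−T(1+s−x)B})ᵢⱼ`. -/
private theorem continuous_pairKernel_apply (T : ℝ) (B : Matrix (Fin 3) (Fin 3) ℝ) (i j : Fin 3) :
    Continuous fun p : ℝ × ℝ => (NormedSpace.exp (-((T * (1 + p.1 - p.2)) • B))) i j := by
  have h := (continuous_exp_smul_apply B i j).comp (by fun_prop : Continuous fun p : ℝ × ℝ => -(T * (1 + p.1 - p.2)))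
  refine h.congr fun p => ?_
  simp only [Function.comp_apply, neg_smul]

/-- Finite double sums with constant coefficients commute with the interval integral (copy of the private `CellLawVQSResp` tool). -/
private theorem integral_sum_sum_mul' {f : Fin 3 → Fin 3 → ℝ → ℝ} {a b : ℝ} (c : Fin 3 → Fin 3 → ℝ)
    (hf : ∀ i j, IntervalIntegrable (f i j) MeasureTheory.volume a b) :
    ∫ x in a..b, ∑ i, ∑ j, c i j * f i j x = ∑ i, ∑ j, c i j * ∫ x in a..b, f i j x := by
  rw [intervalIntegral.integral_finsetSum]
  · refine Finset.sum_congr rfl fun i _ => ?_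
    rw [intervalIntegral.integral_finsetSum]
    · exact Finset.sum_congr rfl fun j _ => intervalIntegral.integral_const_mul _ _
    · exact fun j _ => (hf i j).const_mul _
  · intro i _
    have h := IntervalIntegrable.sum Finset.univ fun j (_ : j ∈ Finset.univ) => (hf i j).const_mul (c i j)
    rw [Finset.sum_fn] at h
    exact h

/-- **The bilinear form of `pairResp` is the double integral of the bilinear form of the pair kernel** (the form of `abs_pairForm_le`). -/
theorem form_pairResp (ρ T : ℝ) (B : Matrix (Fin 3) (Fin 3) ℝ) (v w : Fin 3 → ℝ) :
    ∑ i, ∑ j, v i * pairResp ρ T B i j * w j =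
      T * ∫ s in (0:ℝ)..1, LatticeShear.LatticeWord.trapezoid 0 1 ρ s *
        ∫ x in (0:ℝ)..1, LatticeShear.LatticeWord.trapezoid 0 1 ρ x *
          ∑ i, v i * (NormedSpace.exp (-((T * (1 + s - x)) • B))).mulVec w i := by
  simp_rw [sum_mul_mulVec_eq_sum_sum]
  set α : ℝ → ℝ := fun s => LatticeShear.LatticeWord.trapezoid 0 1 ρ s with hα
  set E : ℝ → ℝ → Fin 3 → Fin 3 → ℝ := fun s x i j => (NormedSpace.exp (-((T * (1 + s - x)) • B))) i j with hE
  have hin : ∀ i j s, IntervalIntegrable (fun x => α x * E s x i j) MeasureTheory.volume 0 1 := fun i j s =>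
    ((continuous_trapezoid_unit ρ).mul
      ((continuous_pairKernel_apply T B i j).comp (continuous_const.prodMk continuous_id))).intervalIntegrable _ _
  have hout : ∀ i j, IntervalIntegrable (fun s => α s * ∫ x in (0:ℝ)..1, α x * E s x i j) MeasureTheory.volume 0 1 := by
    intro i j
    have hf : Continuous (Function.uncurry fun s x : ℝ => α x * E s x i j) :=
      ((continuous_trapezoid_unit ρ).comp continuous_snd).mul (continuous_pairKernel_apply T B i j)
    exact ((continuous_trapezoid_unit ρ).mul
      (intervalIntegral.continuous_parametric_intervalIntegral_of_continuous' hf 0 1)).intervalIntegrable _ _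
  have hinner : ∀ s, ∫ x in (0:ℝ)..1, α x * ∑ i, ∑ j, v i * E s x i j * w j
      = ∑ i, ∑ j, (v i * w j) * ∫ x in (0:ℝ)..1, α x * E s x i j := by
    intro s
    rw [← integral_sum_sum_mul' (fun i j => v i * w j) fun i j => hin i j s]
    refine intervalIntegral.integral_congr fun x _ => ?_
    show α x * ∑ i, ∑ j, v i * E s x i j * w j = ∑ i, ∑ j, (v i * w j) * (α x * E s x i j)
    rw [Finset.mul_sum]
    refine Finset.sum_congr rfl fun i _ => ?_
    rw [Finset.mul_sum]
    refine Finset.sum_congr rfl fun j _ => ?_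
    ring
  have houter : ∫ s in (0:ℝ)..1, α s * ∫ x in (0:ℝ)..1, α x * ∑ i, ∑ j, v i * E s x i j * w j
      = ∑ i, ∑ j, (v i * w j) * ∫ s in (0:ℝ)..1, α s * ∫ x in (0:ℝ)..1, α x * E s x i j := by
    rw [← integral_sum_sum_mul' (fun i j => v i * w j) hout]
    refine intervalIntegral.integral_congr fun s _ => ?_
    show α s * (∫ x in (0:ℝ)..1, α x * ∑ i, ∑ j, v i * E s x i j * w j)
      = ∑ i, ∑ j, (v i * w j) * (α s * ∫ x in (0:ℝ)..1, α x * E s x i j)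
    rw [hinner s, Finset.mul_sum]
    refine Finset.sum_congr rfl fun i _ => ?_
    rw [Finset.mul_sum]
    refine Finset.sum_congr rfl fun j _ => ?_
    ring
  simp only [pairResp]
  rw [houter, Finset.mul_sum]
  refine Finset.sum_congr rfl fun i _ => ?_
  rw [Finset.mul_sum]
  refine Finset.sum_congr rfl fun j _ => ?_
  ring

/-- `pᵀ (P R P) q = (Pp)ᵀ R (Pq)` for a symmetric `P`. -/
private theorem form_PRP (P R : Matrix (Fin 3) (Fin 3) ℝ) (hP : P.transpose = P) (p q : Fin 3 → ℝ) :
    ∑ i, ∑ j, p i * (P * R * P) i j * q j = ∑ i, ∑ j, P.mulVec p i * R i j * P.mulVec q j := by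
  have h : dotProduct p ((P * R * P).mulVec q) = dotProduct (P.mulVec p) (R.mulVec (P.mulVec q)) := by
    rw [← Matrix.mulVec_mulVec, ← Matrix.mulVec_mulVec, Matrix.dotProduct_mulVec, ← Matrix.mulVec_transpose, hP]
  rw [← sum_mul_mulVec_eq_sum_sum, ← sum_mul_mulVec_eq_sum_sum]
  exact h

/-- The regularised block is `10/11`-coercive on ALL of `ℝ³` on the window `NearIso S (10/11) (11/10)` (`window_regBlock`). -/
private theorem regBlock_coercive {S : T4} (hS : Torus.NearIso S (10 / 11) (11 / 10)) (s : Fin 26) (y : Fin 3 → ℝ) :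
    10 / 11 * ∑ i, y i ^ 2 ≤ ∑ i, ∑ j, y i * regBlock S (nj s) i j * y j := by
  have h := (window_regBlock (hn_j s) hS (by norm_num) (by norm_num) y).1
  rw [← sum_mul_mulVec_eq_sum_sum]
  have e1 : dotProduct y y = ∑ i, y i ^ 2 := Finset.sum_congr rfl fun i _ => by ring
  rw [← e1]; exact h

/-- **Per-slot crude bound of the projected pair form**: `|pᵀ(P R P)q| ≤ |Pp||Pq|/(ρ²T³(10/11)⁴)`. -/
theorem abs_form_pairQ_le {S : T4} (hS : Torus.NearIso S (10 / 11) (11 / 10)) (s : Fin 26) (p q : Fin 3 → ℝ) :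
    |∑ i, ∑ j, p i * pairQ S s i j * q j|
      ≤ 1 / ((1 / 2) ^ 2 * slotT s ^ 3 * (10 / 11) ^ 4) * (Real.sqrt (PpSq s p) * Real.sqrt (PpSq s q)) := by
  have hP := WEvenCert.projPerp_transpose (nj s)
  unfold pairQ PpSq
  rw [show mhat (cubatureWord.phase s) = nj s from rfl, show cubatureWord.ramp = (1 / 2 : ℝ) from rfl,
    form_PRP _ _ hP, form_pairResp]
  exact abs_pairForm_le' (regBlock S (nj s)) (by norm_num) (by norm_num) (slotT_pos s) (regBlock_coercive hS s) _ _

/-- **Class enclosures of the crude constant**: `4(11/10)⁴/T_c³ ≤ 2·nC_c` (`T_c ≥ 31.582, 202.12, 575.5` from `π² ≥ 9.8696044`). -/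
theorem crude_le_nC (s : Fin 26) : 1 / ((1 / 2) ^ 2 * slotT s ^ 3 * (10 / 11) ^ 4) ≤ 2 * nC s := by
  rw [slotT_eq]
  obtain ⟨hlo, -⟩ := pi_sq_bounds
  rcases slot_class s with hj | hj | hj
  · obtain ⟨hM, hTj, -⟩ := facts100 s hj
    have hn : nC s = 93 / 1000000 := by unfold nC byClass; rw [hM]; norm_num
    rw [hn, hTj]; unfold T100 MB
    have hX : (31582 / 1000 : ℝ) ≤ 4 * π ^ 2 * 1 * (1 / 50) * 40 := by nlinarith
    calc 1 / ((1 / 2) ^ 2 * (4 * π ^ 2 * 1 * (1 / 50) * 40) ^ 3 * (10 / 11) ^ 4)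
        ≤ 1 / ((1 / 2) ^ 2 * (31582 / 1000 : ℝ) ^ 3 * (10 / 11) ^ 4) := by
          apply one_div_le_one_div_of_le (by norm_num); gcongr
      _ ≤ 2 * (93 / 1000000) := by norm_num
  · obtain ⟨hM, hTj, -, -, -, -⟩ := facts110 s hj
    have hn : nC s = 36 / 100000000 := by unfold nC byClass; rw [hM]; norm_num
    rw [hn, hTj]; unfold T110 MB
    have hX : (20212 / 100 : ℝ) ≤ 4 * π ^ 2 * 2 * (1 / 50) * 128 := by nlinarith
    calc 1 / ((1 / 2) ^ 2 * (4 * π ^ 2 * 2 * (1 / 50) * 128) ^ 3 * (10 / 11) ^ 4)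
        ≤ 1 / ((1 / 2) ^ 2 * (20212 / 100 : ℝ) ^ 3 * (10 / 11) ^ 4) := by
          apply one_div_le_one_div_of_le (by norm_num); gcongr
      _ ≤ 2 * (36 / 100000000) := by norm_num
  · obtain ⟨hM, hTj, -⟩ := facts111 s hj
    have hn : nC s = 16 / 1000000000 := by unfold nC byClass; rw [hM]; norm_num
    rw [hn, hTj]; unfold T111 MB
    have hX : (5755 / 10 : ℝ) ≤ 4 * π ^ 2 * 3 * (1 / 50) * 243 := by nlinarith
    calc 1 / ((1 / 2) ^ 2 * (4 * π ^ 2 * 3 * (1 / 50) * 243) ^ 3 * (10 / 11) ^ 4)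
        ≤ 1 / ((1 / 2) ^ 2 * (5755 / 10 : ℝ) ^ 3 * (10 / 11) ^ 4) := by
          apply one_div_le_one_div_of_le (by norm_num); gcongr
      _ ≤ 2 * (16 / 1000000000) := by norm_num

/-- AM-GM per pair: `|c (e·k)(e'·k) F| ≤ W_l · |Pp| |Pq|`. -/
private theorem pair_term_le {S : T4} (hS : Torus.NearIso S (10 / 11) (11 / 10)) (k p q : Fin 3 → ℝ) (l : Fin 13) :
    |slotCoef cubatureWord (fstSlot l) * (ek (fstSlot l) k * ek (sndSlot l) k) * ∑ i, ∑ j, p i * pairQ S (fstSlot l) i j * q j|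
      ≤ pairW k l * (Real.sqrt (PpSq (fstSlot l) p) * Real.sqrt (PpSq (fstSlot l) q)) := by
  have hc := slotCoef_nonneg cubatureWord (fstSlot l)
  have hF := (abs_form_pairQ_le hS (fstSlot l) p q).trans
    (mul_le_mul_of_nonneg_right (crude_le_nC (fstSlot l)) (by positivity))
  have hee : |ek (fstSlot l) k * ek (sndSlot l) k| ≤ (ek (fstSlot l) k ^ 2 + ek (sndSlot l) k ^ 2) / 2 := by
    rw [abs_mul]
    nlinarith [sq_abs (ek (fstSlot l) k), sq_abs (ek (sndSlot l) k), sq_nonneg (|ek (fstSlot l) k| - |ek (sndSlot l) k|),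
      abs_nonneg (ek (fstSlot l) k), abs_nonneg (ek (sndSlot l) k)]
  rw [abs_mul, abs_mul, abs_of_nonneg hc]
  calc slotCoef cubatureWord (fstSlot l) * |ek (fstSlot l) k * ek (sndSlot l) k| * |∑ i, ∑ j, p i * pairQ S (fstSlot l) i j * q j|
      ≤ slotCoef cubatureWord (fstSlot l) * ((ek (fstSlot l) k ^ 2 + ek (sndSlot l) k ^ 2) / 2)
          * (2 * nC (fstSlot l) * (Real.sqrt (PpSq (fstSlot l) p) * Real.sqrt (PpSq (fstSlot l) q))) :=
        mul_le_mul (mul_le_mul_of_nonneg_left hee hc) hF (abs_nonneg _) (mul_nonneg hc (by positivity))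
    _ = pairW k l * (Real.sqrt (PpSq (fstSlot l) p) * Real.sqrt (PpSq (fstSlot l) q)) := by unfold pairW; ring


/-- **(N) THE NUMERATOR BOUND**: `bsymb (pairQS S)(k;p,q)² ≤ N̄(k,p)·N̄(k,q)` on the block window `NearIso S (10/11) (11/10)`. -/
theorem pairNumBound (S : T4) (hS : Torus.NearIso S (10 / 11) (11 / 10)) (k p q : Fin 3 → ℝ) :
    (Torus.bsymb (pairQS S) k p q) ^ 2 ≤ Nbar k p * Nbar k q := by
  rw [bsymb_pairQS, Nbar_eq_pairs, Nbar_eq_pairs]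
  have hsum : |∑ l, slotCoef cubatureWord (fstSlot l) * (ek (fstSlot l) k * ek (sndSlot l) k) *
      ∑ i, ∑ j, p i * pairQ S (fstSlot l) i j * q j|
        ≤ ∑ l, pairW k l * (Real.sqrt (PpSq (fstSlot l) p) * Real.sqrt (PpSq (fstSlot l) q)) :=
    (Finset.abs_sum_le_sum_abs _ _).trans (Finset.sum_le_sum fun l _ => pair_term_le hS k p q l)
  have hCS : (∑ l, pairW k l * (Real.sqrt (PpSq (fstSlot l) p) * Real.sqrt (PpSq (fstSlot l) q))) ^ 2
      ≤ (∑ l, pairW k l * PpSq (fstSlot l) p) * (∑ l, pairW k l * PpSq (fstSlot l) q) := by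
    have h := Finset.sum_mul_sq_le_sq_mul_sq Finset.univ
      (fun l => Real.sqrt (pairW k l) * Real.sqrt (PpSq (fstSlot l) p))
      (fun l => Real.sqrt (pairW k l) * Real.sqrt (PpSq (fstSlot l) q))
    have e1 : ∑ l, Real.sqrt (pairW k l) * Real.sqrt (PpSq (fstSlot l) p) * (Real.sqrt (pairW k l) * Real.sqrt (PpSq (fstSlot l) q))
        = ∑ l, pairW k l * (Real.sqrt (PpSq (fstSlot l) p) * Real.sqrt (PpSq (fstSlot l) q)) :=
      Finset.sum_congr rfl fun l _ => by
        calc _ = Real.sqrt (pairW k l) * Real.sqrt (pairW k l) * (Real.sqrt (PpSq (fstSlot l) p) * Real.sqrt (PpSq (fstSlot l) q)) := by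
              ring
          _ = _ := by rw [Real.mul_self_sqrt (pairW_nonneg k l)]
    have e2 : ∀ r : Fin 3 → ℝ, ∑ l, (Real.sqrt (pairW k l) * Real.sqrt (PpSq (fstSlot l) r)) ^ 2 = ∑ l, pairW k l * PpSq (fstSlot l) r :=
      fun r => Finset.sum_congr rfl fun l _ => by
        rw [mul_pow, Real.sq_sqrt (pairW_nonneg k l), Real.sq_sqrt (PpSq_nonneg _ _)]
    rw [e1, e2, e2] at h
    exact h
  calc (∑ l, slotCoef cubatureWord (fstSlot l) * (ek (fstSlot l) k * ek (sndSlot l) k) *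
          ∑ i, ∑ j, p i * pairQ S (fstSlot l) i j * q j) ^ 2
      = |∑ l, slotCoef cubatureWord (fstSlot l) * (ek (fstSlot l) k * ek (sndSlot l) k) *
          ∑ i, ∑ j, p i * pairQ S (fstSlot l) i j * q j| ^ 2 := (sq_abs _).symm
    _ ≤ (∑ l, pairW k l * (Real.sqrt (PpSq (fstSlot l) p) * Real.sqrt (PpSq (fstSlot l) q))) ^ 2 :=
        pow_le_pow_left₀ (abs_nonneg _) hsum 2
    _ ≤ _ := hCS

end

end Summit.AnomalousDissipation.AnomalousDissipation.Theorems.SolenoidalFractalHomogenisation.LagrangianStep.D1ResidueCert
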